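import Literature.AlgebraicGeometry.Deformation.SmallExtensionFactorization
import Literature.RingTheory.CompleteLocalRings.FormalImmersionRigidity
import Mathlib.RingTheory.AdicCompletion.RingHom
import Mathlib.LinearAlgebra.Dual.Lemmas
import Mathlib.RingTheory.Ideal.Cotangent
import HarnessLib

/-!
# [Schlessinger1968, Prop. 2.9]: hulls are unique up to (non-canonical) isomorphism — formal couples
# `(R, ξ̂)`, `R ∈ Ĉ`, `ξ̂ ∈ F̂(R)`, the morphism `h_R → F`, the uniqueness of the hull, and (2.8): pro-representing
# couples are hulls, unique up to canonical isomorphism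

Family `hodge` (computation cell `pub-hsemireg`, LIT-W seat «Pridham / derived deformation theory as printed»), layer
`Literature/AlgebraicGeometry/Deformation`. This file types the part of [Schlessinger1968, §2] stated for genuine
pro-couples `(R, ξ)`, `R ∈ Ĉ = Ĉ_Λ` («complete noetherian local `Λ`-algebras `A` for which `A/𝔪ⁿ` is in `C`», §1
p. 209; here `Λ = k`: complete Noetherian local `k`-algebras with residue field `k`, `IsAdicComplete (maximalIdeal R) R`)
and `ξ ∈ F̂(R) = proj lim F(R/𝔪ⁿ)` ((2.1), p. 210; the tree's compatible families on the tower
`ArtAlg.ofPowQuotient R aug n = R/𝔪^{n+1}` of `SmallExtensionFactorization.lean` §4):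

* §1 `F̂(R)`: compatible families (`ArtinFunctor.IsFormalElt`), the multi-step projections, and the morphism
  `h_R → F`, `u ↦ u_* ξ̂ = F(ū)(ξ̂_n)` for `u : R → A`, `A ∈ Art_k`, through any level `n` with `u(𝔪_R^{n+1}) = 0`
  ([Schlessinger1968, (2.2) p. 210: «a morphism `R → A` … `F̂(R) → F(A)`»]) — `formalEvalAt`, `formalEval`, level
  independence, naturality;
* §2 [Def. 2.2, Def. 2.7]: `IsFormallySmooth` («`h_R → F` is smooth», along every surjection of `Art_k`),
  `IsHull` (`+ t_R → t_F` bijective), morphisms of couples `u : (R, ξ̂) → (R', ξ̂')` («`F̂(u)(ξ̂) = ξ̂'`», read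
  levelwise: `(R → R' → R'/𝔪'^{n+1})_* ξ̂ = ξ̂'_n`);
* §3 («by versality», p. 211): a formally smooth couple maps to every formal couple over a complete `R'` —
  `exists_morphism_of_isFormallySmooth` (levelwise lifting along `R'/𝔪'^{n+2} → R'/𝔪'^{n+1}`, then Mathlib's
  universal property `IsAdicComplete.liftAlgHom`);
* §4 [Prop. 2.9]: an endomorphism of a hull inducing the identity on `t_R` is the identity on the cotangent space
  (the points `r ↦ aug(r) + λ[r − aug(r)] ε` of `k[ε]`, `λ ∈ (𝔪/𝔪²)^*`, detect `𝔪/𝔪²` — [Schlessinger1968, (2.6)]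
  `t_R ≅ (𝔪/𝔪²)^*`; a self-contained copy, for `V = k` and `I = 𝔪_R`, of `TangentSpaceOfPoints.lean`'s
  `pointsOfCotangentHom`, so that this file imports `SmallExtensionFactorization.lean` only), hence surjective at
  every level (`Literature.RingTheory.CompleteLocalRings.surjective_mk_pow_comp`, the cotangent criterion), hence
  bijective at every level (finite `k`-dimension), hence an automorphism (completeness); so any morphism between two
  hulls is an ISOMORPHISM: `exists_algEquiv_of_isHull` ((2.8) «In general we have only noncanonical isomorphism:»
  Prop. 2.9 «Let `(R, ξ)` and `(R', ξ')` be hulls of `F`. Then there exists an isomorphism `u : R → R'` such that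
  `F(u)(ξ) = ξ'`.»).
  Also `morphism_unique_of_eval_injective`: out of a PRO-REPRESENTING couple (`h_R(A) → F(A)` injective for all `A`,
  [Thm. 2.11 (2)]) morphisms of couples are unique — so the isomorphism is then unique (cf. (2.18)).
* §5 [§2 p. 210 «pro-represents», (2.8)]: `ProRepresents` («a pro-couple `(R, ξ)` for `F` pro-represents `F` if the
  morphism `h_R → F` induced by `ξ` is an isomorphism»); (2.8) «Notice that if `(R, ξ)` pro-represents `F` then
  `(R, ξ)` is a hull of `F`. In this case `(R, ξ)` is unique up to canonical isomorphism.» — `ProRepresents.isHull`,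
  `ProRepresents.existsUnique_algEquiv` (`∃!` isomorphism of couples), `ProRepresents.algEquiv_trans`.
THEOREMS and definitions with body; no named fact, no `sorry`. Not here: existence of hulls (that is
`HullExistence.lean` / `HullRingForm.lean`).

## References
* [Schlessinger1968] M. Schlessinger, Functors of Artin rings, Trans. AMS 130 (1968) 208–222: §2 (2.1)–(2.2) p. 210,
  Def. 2.2, Def. 2.7, (2.8), Prop. 2.9 p. 211, «pro-represents» p. 210 (held text `paper:doi-10-1090-s0002-9947-1968-0217093-3`
  p0003–p0005, read by eye by seat lit-3 and this lineage).
-/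

namespace Literature.AlgebraicGeometry.Deformation

open IsLocalRing

universe u

noncomputable section

namespace Formal

variable {k : Type u} [Field k] (F : ArtinFunctor.{u} k)
variable (R : Type u) [CommRing R] [Algebra k R] [IsLocalRing R] [IsNoetherianRing R] (aug : R →ₐ[k] k)

/-! ## §1 `F̂(R) = proj lim F(R/𝔪ⁿ)` and the morphism `h_R → F` -/

/-- The objects `R/𝔪_R^{n+1} ∈ Art_k` of the tower (`SmallExtensionFactorization.lean` §4).
[cite: Schlessinger1968, §2 p. 210 («`F̂(A) = proj lim F(A/𝔪ⁿ)`»)] -/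
abbrev Q (n : ℕ) : ArtAlg.{u} k := ArtAlg.ofPowQuotient R aug n

/-- The projection `R → R/𝔪_R^{n+1}`, typed as a map to the object `Q R aug n` of `Art_k`.
[cite: Schlessinger1968, §2 (2.1), p. 210] -/
def mkQ (n : ℕ) : R →ₐ[k] ↥(Q R aug n) := Ideal.Quotient.mkₐ k (maximalIdeal R ^ (n + 1))

/-- Unfolding of `mkQ`: the class of `x` in `R/𝔪^{n+1}`. [cite: Schlessinger1968, §2 (2.1), p. 210] -/
theorem mkQ_apply (n : ℕ) (x : R) : mkQ R aug n x = Ideal.Quotient.mk (maximalIdeal R ^ (n + 1)) x := rfl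

/-- `R → R/𝔪^{n+1}` is onto. [cite: Schlessinger1968, §2 (2.1), p. 210] -/
theorem mkQ_surjective (n : ℕ) : Function.Surjective (mkQ R aug n) := Ideal.Quotient.mk_surjective

/-- The kernel of `R → R/𝔪^{n+1}` is `𝔪^{n+1}`. [cite: Schlessinger1968, §2 (2.1), p. 210] -/
theorem mkQ_eq_zero_iff (n : ℕ) (x : R) : mkQ R aug n x = 0 ↔ x ∈ maximalIdeal R ^ (n + 1) :=
  Ideal.Quotient.eq_zero_iff_mem

/-- The multi-step projection `R/𝔪^{n'+1} → R/𝔪^{n+1}`, `n ≤ n'`. [cite: Schlessinger1968, (2.1), p. 210] -/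
def proj {n n' : ℕ} (h : n ≤ n') : ↥(Q R aug n') →ₐ[k] ↥(Q R aug n) :=
  Ideal.Quotient.factorₐ k (Ideal.pow_le_pow_right (Nat.succ_le_succ h))

/-- The projections of the tower commute with the quotient maps («successive quotients»). [cite: Schlessinger1968, §2 (2.1), p. 210] -/
theorem proj_comp_mkQ {n n' : ℕ} (h : n ≤ n') : (proj R aug h).comp (mkQ R aug n') = mkQ R aug n :=
  AlgHom.ext fun _ => rfl

/-- `proj` at `n ≤ n` is the identity. [cite: Schlessinger1968, §2 (2.1), p. 210] -/
theorem proj_self (n : ℕ) : proj R aug (le_refl n) = AlgHom.id k _ :=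
  Ideal.Quotient.algHom_ext _ (AlgHom.ext fun _ => rfl)

/-- `proj` across `n ≤ n' + 1` factors through the one-step projection. [cite: Schlessinger1968, §2 (2.1), p. 210] -/
theorem proj_succ {n n' : ℕ} (h : n ≤ n') :
    proj R aug (h.trans (Nat.le_succ n')) = (proj R aug h).comp (ArtAlg.powQuotientProj R aug n') :=
  Ideal.Quotient.algHom_ext _ (AlgHom.ext fun _ => rfl)

variable {R aug}

/-- **`ξ̂ ∈ F̂(R)`**: a family `ξ̂_n ∈ F(R/𝔪^{n+1})` compatible under the projections.
[cite: Schlessinger1968, §2 (2.1), p. 210] -/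
def IsFormalElt (ξ : ∀ n, F.obj (Q R aug n)) : Prop :=
  ∀ n, F.map (ArtAlg.powQuotientProj R aug n) (ξ (n + 1)) = ξ n

variable {F}

/-- Compatibility across several levels. [cite: Schlessinger1968, §2 (2.1), p. 210] -/
theorem IsFormalElt.map_proj {ξ : ∀ n, F.obj (Q R aug n)} (hξ : IsFormalElt F ξ) {n n' : ℕ} (h : n ≤ n') :
    F.map (proj R aug h) (ξ n') = ξ n := by
  induction n', h using Nat.le_induction with
  | base => rw [proj_self, F.map_id]
  | succ n' h ih => rw [proj_succ R aug h, F.map_comp, hξ n', ih]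

variable (R aug)

omit [IsNoetherianRing R] in
/-- `k`-algebra maps from the local `R` to an object `C` of `Art_k` are LOCAL (`aug_C ∘ u` is an augmentation of `R`,
its kernel is `𝔪_R`). Same statement as `HullLiftingStep.lean`'s `ArtAlg.map_maximalIdeal_le_of_isLocalRing`
(not imported, to keep this file at the import level of `SmallExtensionFactorization.lean`).
[cite: Schlessinger1968, §1 p. 209 («local `Λ`-algebras … residue field `k`»)] -/
theorem map_maximalIdeal_le_artAlg (C : ArtAlg.{u} k) (u : R →ₐ[k] ↥C) : (maximalIdeal R).map u ≤ maximalIdeal ↥C := by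
  obtain ⟨augC⟩ := C.exists_augmentation
  rw [Ideal.map_le_iff_le_comap]
  intro x hx
  rw [Ideal.mem_comap, ← ArtAlg.ker_augmentation_eq_maximalIdeal C augC, RingHom.mem_ker]
  have hker : RingHom.ker ((augC.comp u : R →ₐ[k] k) : R →+* k) = maximalIdeal R :=
    IsLocalRing.ker_eq_maximalIdeal _ fun c => ⟨algebraMap k R c, by simp⟩
  have : x ∈ RingHom.ker ((augC.comp u : R →ₐ[k] k) : R →+* k) := by rw [hker]; exact hx
  simpa [RingHom.mem_ker] using this

omit [IsNoetherianRing R] in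
/-- A `k`-algebra map `u : R → C`, `C ∈ Art_k`, kills some `𝔪_R^{n+1}` (`𝔪_C` nilpotent, `u` local).
[cite: Schlessinger1968, (2.2), p. 210] -/
theorem exists_pow_le_ker {C : ArtAlg.{u} k} (u : R →ₐ[k] ↥C) :
    ∃ n : ℕ, maximalIdeal R ^ (n + 1) ≤ RingHom.ker u := by
  obtain ⟨n, hn⟩ := ArtAlg.exists_pow_maximalIdeal_eq_bot ↥C
  refine ⟨n, fun x hx => ?_⟩
  rw [RingHom.mem_ker]
  have h1 : u x ∈ (maximalIdeal R ^ (n + 1)).map u := Ideal.mem_map_of_mem _ hx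
  rw [Ideal.map_pow] at h1
  have h2 : (maximalIdeal R).map u ^ (n + 1) ≤ maximalIdeal ↥C ^ (n + 1) :=
    Ideal.pow_right_mono (map_maximalIdeal_le_artAlg R C u) _
  have h3 : maximalIdeal ↥C ^ (n + 1) ≤ maximalIdeal ↥C ^ n := Ideal.pow_le_pow_right n.le_succ
  have := h3 (h2 h1)
  rwa [hn, Ideal.mem_bot] at this

/-- The factorisation `ū : R/𝔪^{n+1} → C` of `u` through a level it kills. [cite: Schlessinger1968, (2.2), p. 210] -/
def bar {C : ArtAlg.{u} k} (n : ℕ) (u : R →ₐ[k] ↥C) (hu : maximalIdeal R ^ (n + 1) ≤ RingHom.ker u) :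
    ↥(Q R aug n) →ₐ[k] ↥C :=
  Ideal.Quotient.liftₐ (maximalIdeal R ^ (n + 1)) u fun _ ha => hu ha

/-- `ū ∘ (R → R/𝔪^{n+1}) = u`. [cite: Schlessinger1968, §2 (2.2)–(2.3), p. 210] -/
theorem bar_comp_mkQ {C : ArtAlg.{u} k} (n : ℕ) (u : R →ₐ[k] ↥C) (hu : maximalIdeal R ^ (n + 1) ≤ RingHom.ker u) :
    (bar R aug n u hu).comp (mkQ R aug n) = u :=
  AlgHom.ext fun _ => rfl

/-- The factorisation `ū` of `u` through `R/𝔪^{n+1}` is unique. [cite: Schlessinger1968, §2 (2.2)–(2.3), p. 210] -/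
theorem bar_unique {C : ArtAlg.{u} k} (n : ℕ) (u : R →ₐ[k] ↥C) (hu : maximalIdeal R ^ (n + 1) ≤ RingHom.ker u)
    (g : ↥(Q R aug n) →ₐ[k] ↥C) (hg : g.comp (mkQ R aug n) = u) : g = bar R aug n u hu :=
  Ideal.Quotient.algHom_ext _ (AlgHom.ext fun x =>
    (AlgHom.congr_fun hg x).trans (AlgHom.congr_fun (bar_comp_mkQ R aug n u hu) x).symm)

/-- Factorisations at two levels are related by the projection. [cite: Schlessinger1968, §2 (2.2)–(2.3), p. 210] -/
theorem bar_comp_proj {C : ArtAlg.{u} k} {n n' : ℕ} (h : n ≤ n') (u : R →ₐ[k] ↥C)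
    (hu : maximalIdeal R ^ (n + 1) ≤ RingHom.ker u) (hu' : maximalIdeal R ^ (n' + 1) ≤ RingHom.ker u) :
    (bar R aug n u hu).comp (proj R aug h) = bar R aug n' u hu' :=
  bar_unique R aug n' u hu' _ (by rw [AlgHom.comp_assoc, proj_comp_mkQ, bar_comp_mkQ])

variable (F)

/-- **The morphism `h_R → F` induced by `ξ̂`**, at a level: `u ↦ F(ū)(ξ̂_n)` for `u(𝔪^{n+1}) = 0` ([Schlessinger1968,
(2.2), p. 210]: a morphism `R → A` induces `F̂(R) → F̂(A) = F(A)`). [cite: Schlessinger1968, §2 (2.2), p. 210] -/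
def evalAt (ξ : ∀ n, F.obj (Q R aug n)) {C : ArtAlg.{u} k} (n : ℕ) (u : R →ₐ[k] ↥C)
    (hu : maximalIdeal R ^ (n + 1) ≤ RingHom.ker u) : F.obj C :=
  F.map (bar R aug n u hu) (ξ n)

variable {F}

/-- Level independence of the evaluation. [cite: Schlessinger1968, §2 (2.1)–(2.2), p. 210] -/
theorem evalAt_eq_evalAt {ξ : ∀ n, F.obj (Q R aug n)} (hξ : IsFormalElt F ξ) {C : ArtAlg.{u} k} (n n' : ℕ)
    (u : R →ₐ[k] ↥C) (hu : maximalIdeal R ^ (n + 1) ≤ RingHom.ker u)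
    (hu' : maximalIdeal R ^ (n' + 1) ≤ RingHom.ker u) :
    evalAt F R aug ξ n u hu = evalAt F R aug ξ n' u hu' := by
  wlog h : n ≤ n' generalizing n n'
  · exact (this n' n hu' hu (le_of_not_ge h)).symm
  unfold evalAt
  rw [← bar_comp_proj R aug h u hu hu', F.map_comp, hξ.map_proj h]

variable (F)

/-- **`u ↦ u_* ξ̂ : h_R(C) → F(C)`** (at the level supplied by `exists_pow_le_ker`).
[cite: Schlessinger1968, §2 (2.2), p. 210] -/
def eval (ξ : ∀ n, F.obj (Q R aug n)) {C : ArtAlg.{u} k} (u : R →ₐ[k] ↥C) : F.obj C :=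
  evalAt F R aug ξ (Classical.choose (exists_pow_le_ker R u)) u (Classical.choose_spec (exists_pow_le_ker R u))

variable {F}

/-- `u_* ξ̂` may be computed at any level killed by `u`. [cite: Schlessinger1968, §2 (2.2)–(2.3), p. 210] -/
theorem eval_eq_evalAt {ξ : ∀ n, F.obj (Q R aug n)} (hξ : IsFormalElt F ξ) {C : ArtAlg.{u} k} (n : ℕ)
    (u : R →ₐ[k] ↥C) (hu : maximalIdeal R ^ (n + 1) ≤ RingHom.ker u) :
    eval F R aug ξ u = evalAt F R aug ξ n u hu :=
  evalAt_eq_evalAt R aug hξ _ _ u _ hu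

/-- Evaluating at the projection `R → R/𝔪^{n+1}` itself returns `ξ̂_n`. [cite: Schlessinger1968, §2 (2.1), p. 210] -/
theorem eval_mkQ {ξ : ∀ n, F.obj (Q R aug n)} (hξ : IsFormalElt F ξ) (n : ℕ) : eval F R aug ξ (mkQ R aug n) = ξ n := by
  have hu : maximalIdeal R ^ (n + 1) ≤ RingHom.ker (mkQ R aug n) := fun x hx => by
    rw [RingHom.mem_ker]
    exact (mkQ_eq_zero_iff R aug n x).2 hx
  rw [eval_eq_evalAt R aug hξ n _ hu]
  unfold evalAt
  rw [← bar_unique R aug n _ hu (AlgHom.id k _) (AlgHom.id_comp _), F.map_id]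

/-- Naturality: `(v ∘ u)_* ξ̂ = F(v)(u_* ξ̂)`. [cite: Schlessinger1968, §2 (2.2), p. 210] -/
theorem eval_comp {ξ : ∀ n, F.obj (Q R aug n)} (hξ : IsFormalElt F ξ) {C D : ArtAlg.{u} k} (u : R →ₐ[k] ↥C)
    (v : ↥C →ₐ[k] ↥D) : eval F R aug ξ (v.comp u) = F.map v (eval F R aug ξ u) := by
  obtain ⟨n, hu⟩ := exists_pow_le_ker R u
  have hvu : maximalIdeal R ^ (n + 1) ≤ RingHom.ker (v.comp u) := fun x hx => by
    have := hu hx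
    rw [RingHom.mem_ker] at this ⊢
    change v (u x) = 0
    rw [this, map_zero]
  rw [eval_eq_evalAt R aug hξ n u hu, eval_eq_evalAt R aug hξ n (v.comp u) hvu]
  unfold evalAt
  rw [← F.map_comp]
  congr 1
  exact (bar_unique R aug n (v.comp u) hvu (v.comp (bar R aug n u hu)) (by rw [AlgHom.comp_assoc, bar_comp_mkQ])).symm

/-! ## §2 [Def. 2.2, Def. 2.7]: smooth couples, hulls, morphisms of couples -/

variable (F)

/-- **«`h_R → F` is smooth»** ([Def. 2.2]) for the morphism defined by `ξ̂`: along every surjection `p : A' → A`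
of `Art_k`, every `u : R → A` with `η' ∈ F(A')` over `u_* ξ̂` lifts to `u' : R → A'`, `p ∘ u' = u`, `u'_* ξ̂ = η'`.
[cite: Schlessinger1968, Def. 2.2 p. 210 and Def. 2.7 p. 211] -/
def IsFormallySmooth (ξ : ∀ n, F.obj (Q R aug n)) : Prop :=
  ∀ ⦃A' A : ArtAlg.{u} k⦄ (p : ↥A' →ₐ[k] ↥A), Function.Surjective p →
    ∀ (u : R →ₐ[k] ↥A) (η' : F.obj A'), F.map p η' = eval F R aug ξ u →
      ∃ u' : R →ₐ[k] ↥A', p.comp u' = u ∧ eval F R aug ξ u' = η'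

/-- **[Schlessinger1968, Def. 2.7] — `(R, ξ̂)` is a HULL of `F`:** `ξ̂ ∈ F̂(R)`, `h_R → F` is smooth, and
`t_R = Hom(R, k[ε]) → t_F = F(k[ε])` is bijective. [cite: Schlessinger1968, Def. 2.7, p. 211] -/
def IsHull (ξ : ∀ n, F.obj (Q R aug n)) : Prop :=
  IsFormalElt F ξ ∧ IsFormallySmooth F R aug ξ ∧
    Function.Bijective fun φ : R →ₐ[k] ↥(ArtAlg.sqZeroExt (k := k) k) => eval F R aug ξ φ

variable (R' : Type u) [CommRing R'] [Algebra k R'] [IsLocalRing R'] [IsNoetherianRing R'] (aug' : R' →ₐ[k] k)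

/-- **A morphism of couples `u : (R, ξ̂) → (R', ξ̂')`** ((2.2): «`F̂(u)(ξ̂) = ξ̂'`», i.e. for every level
`(R → R' → R'/𝔪'^{n+1})_* ξ̂ = ξ̂'_n`). [cite: Schlessinger1968, §2 (2.2), p. 210] -/
def IsMorphism (ξ : ∀ n, F.obj (Q R aug n)) (ξ' : ∀ n, F.obj (Q R' aug' n)) (u : R →ₐ[k] R') : Prop :=
  ∀ n, eval F R aug ξ ((mkQ R' aug' n).comp u) = ξ' n

/-! ## §3 «By versality»: a smooth couple maps to every formal couple over a complete ring -/

section Versality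

variable {R aug R' aug'}

/-- `F(R'/𝔪') = F(k)` is one point. [cite: Schlessinger1968, §2 p. 210 («`F(k)` (is) just one element»)] -/
theorem obj_Q_zero_subsingleton (pt : F.obj (ArtAlg.base k)) (hpt : ∀ a, a = pt) (x y : F.obj (Q R' aug' 0)) :
    x = y := by
  obtain ⟨aug₀⟩ := (Q R' aug' 0).exists_augmentation
  have hb : Function.Bijective (ArtAlg.toBase (k := k) aug₀) := ArtAlg.ofPowQuotient_zero_bijective R' aug' aug₀
  let e : ↥(Q R' aug' 0) ≃ₐ[k] ↥(ArtAlg.base k) := AlgEquiv.ofBijective (ArtAlg.toBase (k := k) aug₀) hb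
  have key : ∀ z : F.obj (Q R' aug' 0), z = F.map (e.symm : ↥(ArtAlg.base k) →ₐ[k] ↥(Q R' aug' 0))
      (F.map (e : ↥(Q R' aug' 0) →ₐ[k] ↥(ArtAlg.base k)) z) := fun z => by
    rw [← F.map_comp, AlgEquiv.symm_comp, F.map_id]
  rw [key x, key y, hpt (F.map _ x), hpt (F.map _ y)]

variable {F}

/-- One step of the levelwise lifting `R → R'/𝔪'^{n+2}` over `R → R'/𝔪'^{n+1}` by smoothness of `h_R → F` along the
surjection `R'/𝔪'^{n+2} → R'/𝔪'^{n+1}`. [cite: Schlessinger1968, Def. 2.2 p. 210 and (2.8)–Prop. 2.9 p. 211] -/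
theorem exists_step {ξ : ∀ n, F.obj (Q R aug n)} {ξ' : ∀ n, F.obj (Q R' aug' n)}
    (hsm : IsFormallySmooth F R aug ξ) (hξ' : IsFormalElt F ξ') (n : ℕ)
    (v : {v : R →ₐ[k] ↥(Q R' aug' n) // eval F R aug ξ v = ξ' n}) :
    ∃ v' : {v' : R →ₐ[k] ↥(Q R' aug' (n + 1)) // eval F R aug ξ v' = ξ' (n + 1)},
      (ArtAlg.powQuotientProj R' aug' n).comp v'.1 = v.1 := by
  obtain ⟨v', h1, h2⟩ := hsm (ArtAlg.powQuotientProj R' aug' n) (ArtAlg.powQuotientProj_surjective R' aug' n)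
    v.1 (ξ' (n + 1)) (by rw [hξ' n, v.2])
  exact ⟨⟨v', h2⟩, h1⟩

/-- The base level `R → k → R'/𝔪'` of the levelwise lifting. [cite: Schlessinger1968, Prop. 2.9 (proof), p. 211] -/
def liftZero : R →ₐ[k] ↥(Q R' aug' 0) := (mkQ R' aug' 0).comp ((Algebra.ofId k R').comp aug)

/-- **The levelwise liftings `v_n : R → R'/𝔪'^{n+1}` with `(v_n)_* ξ̂ = ξ̂'_n`**, each over the previous one, chosen by
recursion (smoothness of `h_R → F`, `exists_step`). [cite: Schlessinger1968, Prop. 2.9 (proof: «by versality»), p. 211] -/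
def lifts {ξ : ∀ n, F.obj (Q R aug n)} {ξ' : ∀ n, F.obj (Q R' aug' n)} (pt : F.obj (ArtAlg.base k))
    (hpt : ∀ a, a = pt) (hsm : IsFormallySmooth F R aug ξ) (hξ' : IsFormalElt F ξ') :
    ∀ n, {v : R →ₐ[k] ↥(Q R' aug' n) // eval F R aug ξ v = ξ' n}
  | 0 => ⟨liftZero (R := R) (aug := aug) (R' := R') (aug' := aug'),
      obj_Q_zero_subsingleton (F := F) pt hpt _ _⟩
  | n + 1 => Classical.choose (exists_step hsm hξ' n (lifts pt hpt hsm hξ' n))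

/-- Each levelwise lifting lies over the previous one (one-step projection). [cite: Schlessinger1968, (2.4) and Prop. 2.9 (proof), p. 211] -/
theorem powQuotientProj_comp_lifts {ξ : ∀ n, F.obj (Q R aug n)} {ξ' : ∀ n, F.obj (Q R' aug' n)}
    (pt : F.obj (ArtAlg.base k)) (hpt : ∀ a, a = pt) (hsm : IsFormallySmooth F R aug ξ) (hξ' : IsFormalElt F ξ')
    (n : ℕ) :
    (ArtAlg.powQuotientProj R' aug' n).comp (lifts pt hpt hsm hξ' (n + 1)).1 = (lifts pt hpt hsm hξ' n).1 :=
  Classical.choose_spec (exists_step hsm hξ' n (lifts pt hpt hsm hξ' n))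

/-- The levelwise liftings are compatible under all projections of the tower of `R'`. [cite: Schlessinger1968, (2.4) and Prop. 2.9 (proof), p. 211] -/
theorem proj_comp_lifts {ξ : ∀ n, F.obj (Q R aug n)} {ξ' : ∀ n, F.obj (Q R' aug' n)}
    (pt : F.obj (ArtAlg.base k)) (hpt : ∀ a, a = pt) (hsm : IsFormallySmooth F R aug ξ) (hξ' : IsFormalElt F ξ')
    {m n : ℕ} (h : m ≤ n) :
    (proj R' aug' h).comp (lifts pt hpt hsm hξ' n).1 = (lifts pt hpt hsm hξ' m).1 := by
  induction n, h using Nat.le_induction with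
  | base => rw [proj_self, AlgHom.id_comp]
  | succ n h ih => rw [proj_succ R' aug' h, AlgHom.comp_assoc, powQuotientProj_comp_lifts, ih]

/-- The compatible family `R → R'/𝔪'^m` (all `m`, via one more projection) fed to the universal property of the
complete ring `R'`. [cite: Schlessinger1968, §1 p. 209 (`Ĉ`: complete)] -/
def liftFamily {ξ : ∀ n, F.obj (Q R aug n)} {ξ' : ∀ n, F.obj (Q R' aug' n)} (pt : F.obj (ArtAlg.base k))
    (hpt : ∀ a, a = pt) (hsm : IsFormallySmooth F R aug ξ) (hξ' : IsFormalElt F ξ') (m : ℕ) :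
    R →ₐ[k] R' ⧸ maximalIdeal R' ^ m :=
  (Ideal.Quotient.factorₐ k (Ideal.pow_le_pow_right (Nat.le_succ m))).comp (lifts pt hpt hsm hξ' m).1

/-- The family `R → R'/𝔪'^m` is compatible (hypothesis of the adic universal property). [cite: Schlessinger1968, (2.4) and Prop. 2.9 (proof), p. 211] -/
theorem liftFamily_compat {ξ : ∀ n, F.obj (Q R aug n)} {ξ' : ∀ n, F.obj (Q R' aug' n)} (pt : F.obj (ArtAlg.base k))
    (hpt : ∀ a, a = pt) (hsm : IsFormallySmooth F R aug ξ) (hξ' : IsFormalElt F ξ') {m n : ℕ} (hle : m ≤ n) :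
    (Ideal.Quotient.factorₐ k (Ideal.pow_le_pow_right hle)).comp (liftFamily pt hpt hsm hξ' n) =
      liftFamily pt hpt hsm hξ' m := by
  unfold liftFamily
  rw [← proj_comp_lifts pt hpt hsm hξ' hle]
  refine AlgHom.ext fun x => ?_
  change (Ideal.Quotient.factorₐ k (Ideal.pow_le_pow_right hle))
      ((Ideal.Quotient.factorₐ k (Ideal.pow_le_pow_right (Nat.le_succ n))) ((lifts pt hpt hsm hξ' n).1 x)) =
    (Ideal.Quotient.factorₐ k (Ideal.pow_le_pow_right (Nat.le_succ m))) (proj R' aug' hle ((lifts pt hpt hsm hξ' n).1 x))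
  generalize (lifts pt hpt hsm hξ' n).1 x = y
  obtain ⟨z, rfl⟩ := Ideal.Quotient.mk_surjective y
  rfl

variable [IsAdicComplete (maximalIdeal R') R']

/-- **The morphism `u : R → R'` («by versality»)**, the limit of the levelwise liftings (Mathlib's
`IsAdicComplete.liftAlgHom`). [cite: Schlessinger1968, Prop. 2.9 (proof), p. 211] -/
def liftHom {ξ : ∀ n, F.obj (Q R aug n)} {ξ' : ∀ n, F.obj (Q R' aug' n)} (pt : F.obj (ArtAlg.base k))
    (hpt : ∀ a, a = pt) (hsm : IsFormallySmooth F R aug ξ) (hξ' : IsFormalElt F ξ') : R →ₐ[k] R' :=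
  IsAdicComplete.liftAlgHom (maximalIdeal R') (liftFamily pt hpt hsm hξ') (liftFamily_compat pt hpt hsm hξ')

/-- The limit morphism `u : R → R'` reduces to the levelwise liftings. [cite: Schlessinger1968, (2.4) and Prop. 2.9 (proof), p. 211] -/
theorem mkQ_comp_liftHom {ξ : ∀ n, F.obj (Q R aug n)} {ξ' : ∀ n, F.obj (Q R' aug' n)} (pt : F.obj (ArtAlg.base k))
    (hpt : ∀ a, a = pt) (hsm : IsFormallySmooth F R aug ξ) (hξ' : IsFormalElt F ξ') (n : ℕ) :
    (mkQ R' aug' n).comp (liftHom pt hpt hsm hξ') = (lifts pt hpt hsm hξ' n).1 := by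
  refine AlgHom.ext fun x => ?_
  have h := AlgHom.congr_fun (IsAdicComplete.mkₐ_comp_liftAlgHom (maximalIdeal R') (liftFamily pt hpt hsm hξ')
    (liftFamily_compat pt hpt hsm hξ') (n + 1)) x
  exact h.trans (AlgHom.congr_fun (powQuotientProj_comp_lifts pt hpt hsm hξ' n) x)

/-- **«By versality there is a morphism `(R, ξ̂) → (R', ξ̂')`»**: if `h_R → F` is smooth (for `ξ̂ ∈ F̂(R)`) and
`ξ̂' ∈ F̂(R')` with `R'` complete, there is `u : R → R'` with `F̂(u)(ξ̂) = ξ̂'`. [cite: Schlessinger1968, (2.8) and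
Prop. 2.9 (proof), p. 211, with Def. 2.2 p. 210] -/
theorem exists_morphism_of_isFormallySmooth {ξ : ∀ n, F.obj (Q R aug n)} {ξ' : ∀ n, F.obj (Q R' aug' n)}
    (pt : F.obj (ArtAlg.base k)) (hpt : ∀ a, a = pt) (hsm : IsFormallySmooth F R aug ξ) (hξ' : IsFormalElt F ξ') :
    ∃ u : R →ₐ[k] R', IsMorphism F R aug R' aug' ξ ξ' u :=
  ⟨liftHom pt hpt hsm hξ', fun n => by rw [mkQ_comp_liftHom]; exact (lifts pt hpt hsm hξ' n).2⟩

end Versality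

/-! ## §4 [Prop. 2.9]: a hull is unique up to (non-canonical) isomorphism -/

section Uniqueness

variable {F R aug R' aug'}
variable {R'' : Type u} [CommRing R''] [Algebra k R''] [IsLocalRing R''] [IsNoetherianRing R''] {aug'' : R'' →ₐ[k] k}

/-- Morphisms of couples compose. [cite: Schlessinger1968, §2 (2.2), p. 210] -/
theorem IsMorphism.comp {ξ : ∀ n, F.obj (Q R aug n)} {ξ' : ∀ n, F.obj (Q R' aug' n)}
    {ξ'' : ∀ n, F.obj (Q R'' aug'' n)} (hξ : IsFormalElt F ξ) (hξ' : IsFormalElt F ξ')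
    {u : R →ₐ[k] R'} {u' : R' →ₐ[k] R''} (hu : IsMorphism F R aug R' aug' ξ ξ' u)
    (hu' : IsMorphism F R' aug' R'' aug'' ξ' ξ'' u') : IsMorphism F R aug R'' aug'' ξ ξ'' (u'.comp u) := by
  intro n
  -- `R' → R'' → R''/𝔪''^{n+1}` kills some `𝔪'^{m+1}`: read it through `R'/𝔪'^{m+1}`
  obtain ⟨m, hm⟩ := exists_pow_le_ker R' ((mkQ R'' aug'' n).comp u')
  have e1 : (mkQ R'' aug'' n).comp (u'.comp u) = (bar R' aug' m _ hm).comp ((mkQ R' aug' m).comp u) := by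
    rw [← AlgHom.comp_assoc, ← AlgHom.comp_assoc, bar_comp_mkQ]
  rw [e1, eval_comp R aug hξ, hu m]
  change evalAt F R' aug' ξ' m _ hm = ξ'' n
  rw [← eval_eq_evalAt R' aug' hξ' m _ hm, hu' n]

/-- The identity is a morphism of couples. [cite: Schlessinger1968, §2 (2.2), p. 210] -/
theorem IsMorphism.id {ξ : ∀ n, F.obj (Q R aug n)} (hξ : IsFormalElt F ξ) :
    IsMorphism F R aug R aug ξ ξ (AlgHom.id k R) := fun n => by
  rw [AlgHom.comp_id]; exact eval_mkQ R aug hξ n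

/-- An endomorphism `w` of a couple `(R, ξ̂)` acts trivially on `h_R(k[ε]) → F(k[ε])`: `(φ ∘ w)_* ξ̂ = φ_* ξ̂`.
[cite: Schlessinger1968, Prop. 2.9 (proof: «`u'u` induces an isomorphism on tangent spaces»), p. 211] -/
theorem eval_comp_endo {ξ : ∀ n, F.obj (Q R aug n)} (hξ : IsFormalElt F ξ) {w : R →ₐ[k] R}
    (hw : IsMorphism F R aug R aug ξ ξ w) (φ : R →ₐ[k] ↥(ArtAlg.sqZeroExt (k := k) k)) :
    eval F R aug ξ (φ.comp w) = eval F R aug ξ φ := by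
  obtain ⟨m, hm⟩ := exists_pow_le_ker R φ
  have e1 : φ.comp w = (bar R aug m φ hm).comp ((mkQ R aug m).comp w) := by
    rw [← AlgHom.comp_assoc, bar_comp_mkQ]
  rw [e1, eval_comp R aug hξ, hw m]
  change evalAt F R aug ξ m φ hm = _
  rw [← eval_eq_evalAt R aug hξ m φ hm]

variable (aug)

omit [IsNoetherianRing R] in
/-- `k`-algebra endomorphisms of a local `k`-algebra with residue field `k` preserve the augmentation and the maximal
ideal. [cite: Schlessinger1968, §1, p. 209 (local `Λ`-algebras with residue field `k`)] -/
theorem aug_comp_endo (w : R →ₐ[k] R) : aug.comp w = aug := by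
  refine AlgHom.ext fun x => ?_
  have hker : RingHom.ker (aug : R →+* k) = maximalIdeal R :=
    IsLocalRing.ker_eq_maximalIdeal _ fun c => ⟨algebraMap k R c, by simp⟩
  have hker' : RingHom.ker ((aug.comp w : R →ₐ[k] k) : R →+* k) = maximalIdeal R :=
    IsLocalRing.ker_eq_maximalIdeal _ fun c => ⟨algebraMap k R c, by simp⟩
  have hx : x - algebraMap k R (aug x) ∈ RingHom.ker (aug : R →+* k) := by
    rw [RingHom.mem_ker, map_sub]; simp
  rw [hker, ← hker', RingHom.mem_ker] at hx
  have : aug (w (x - algebraMap k R (aug x))) = 0 := hx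
  rw [map_sub, map_sub, AlgHom.commutes, AlgHom.commutes, sub_eq_zero] at this
  exact this

omit [IsNoetherianRing R] in
include aug in
/-- A `k`-algebra endomorphism of `R` is local (it preserves the augmentation, whose kernel is `𝔪_R`). [cite: Schlessinger1968, §1, p. 209 (local `Λ`-algebras with residue field `k`)] -/
theorem map_maximalIdeal_le_of_endo (w : R →ₐ[k] R) : (maximalIdeal R).map w ≤ maximalIdeal R := by
  have hker : RingHom.ker (aug : R →+* k) = maximalIdeal R :=
    IsLocalRing.ker_eq_maximalIdeal _ fun c => ⟨algebraMap k R c, by simp⟩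
  rw [Ideal.map_le_iff_le_comap]
  intro x hx
  rw [← hker, RingHom.mem_ker] at hx
  rw [Ideal.mem_comap, ← hker, RingHom.mem_ker]
  change aug (w x) = 0
  rw [← AlgHom.comp_apply, aug_comp_endo aug]
  exact hx

/-! ### The points `r ↦ aug(r) + λ[r − aug(r)] ε` of `k[ε]` ([Schlessinger1968, (2.6)]: `t_R ≅ (𝔪/𝔪²)^*`) -/

omit [IsNoetherianRing R] in
/-- `r − aug(r)·1 ∈ 𝔪_R` (the kernel of the augmentation is `𝔪_R`). [cite: Schlessinger1968, (2.6), p. 211] -/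
theorem sub_algebraMap_aug_mem (r : R) : r - algebraMap k R (aug r) ∈ maximalIdeal R := by
  have hker : RingHom.ker (aug : R →+* k) = maximalIdeal R :=
    IsLocalRing.ker_eq_maximalIdeal _ fun c => ⟨algebraMap k R c, by simp⟩
  rw [← hker, RingHom.mem_ker, map_sub]
  change aug r - aug (algebraMap k R (aug r)) = 0
  simp

/-- `δ : r ↦ r − aug(r)·1 : R → 𝔪` (`k`-linear). [cite: Schlessinger1968, (2.6), p. 211] -/
def cotProj : R →ₗ[k] ↥(maximalIdeal R) where
  toFun r := ⟨r - algebraMap k R (aug r), sub_algebraMap_aug_mem aug r⟩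
  map_add' r s := Subtype.ext (by
    change r + s - algebraMap k R (aug (r + s)) = (r - algebraMap k R (aug r)) + (s - algebraMap k R (aug s))
    rw [map_add, map_add]; ring)
  map_smul' c r := Subtype.ext (by
    change c • r - algebraMap k R (aug (c • r)) = c • (r - algebraMap k R (aug r))
    rw [map_smul, smul_eq_mul, map_mul, smul_sub, Algebra.smul_def, Algebra.smul_def])

omit [IsNoetherianRing R] in
/-- On `𝔪_R` the map `δ : r ↦ r − aug(r)·1` is the identity. [cite: Schlessinger1968, (2.6), p. 211] -/
theorem cotProj_coe (x : ↥(maximalIdeal R)) : cotProj aug (x : R) = x := Subtype.ext (by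
  have hker : RingHom.ker (aug : R →+* k) = maximalIdeal R :=
    IsLocalRing.ker_eq_maximalIdeal _ fun c => ⟨algebraMap k R c, by simp⟩
  have hx : (aug : R →+* k) x = 0 := by rw [← RingHom.mem_ker, hker]; exact x.2
  change (x : R) - algebraMap k R ((aug : R →+* k) x) = x
  rw [hx, map_zero, sub_zero])

omit [IsNoetherianRing R] in
/-- The Leibniz defect of `δ` lies in `𝔪²`: `[δ(rs)] = aug(r) [δ s] + aug(s) [δ r]` in `𝔪/𝔪²`.
[cite: Schlessinger1968, (2.6), p. 211] -/
theorem toCotangent_cotProj_mul (r s : R) :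
    (maximalIdeal R).toCotangent (cotProj aug (r * s)) =
      aug r • (maximalIdeal R).toCotangent (cotProj aug s) + aug s • (maximalIdeal R).toCotangent (cotProj aug r) := by
  rw [← algebraMap_smul R (aug r), ← algebraMap_smul R (aug s), ← (maximalIdeal R).toCotangent.map_smul,
    ← (maximalIdeal R).toCotangent.map_smul, ← (maximalIdeal R).toCotangent.map_add, Ideal.toCotangent_eq, pow_two]
  have h : (cotProj aug (r * s) : R) -
      ((algebraMap k R (aug r) • cotProj aug s + algebraMap k R (aug s) • cotProj aug r : ↥(maximalIdeal R)) : R) =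
      (cotProj aug r : R) * (cotProj aug s : R) := by
    change r * s - algebraMap k R (aug (r * s)) -
        (algebraMap k R (aug r) * (s - algebraMap k R (aug s)) + algebraMap k R (aug s) * (r - algebraMap k R (aug r))) =
      (r - algebraMap k R (aug r)) * (s - algebraMap k R (aug s))
    rw [map_mul, map_mul]; ring
  rw [h]
  exact Ideal.mul_mem_mul (cotProj aug r).2 (cotProj aug s).2

/-- **The point `φ_λ : R → k[ε]`, `r ↦ aug(r) + λ[r − aug(r)] ε`, attached to a linear functional `λ` on `𝔪/𝔪²`**
(an algebra map because the Leibniz defect of `δ` lies in `𝔪²`). Self-contained copy (for `V = k`, `I = 𝔪_R`) of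
`TangentSpaceOfPoints.lean`'s `ArtinFunctor.pointsOfCotangentHom`. Definition with body.
[cite: Schlessinger1968, (2.6), p. 211 («`t_R ≅ Hom(R, k[ε])`»)] -/
def cotPoint (lam : (maximalIdeal R).Cotangent →ₗ[k] k) : R →ₐ[k] ↥(ArtAlg.sqZeroExt (k := k) k) :=
  show R →ₐ[k] TrivSqZeroExt k k from
  { toFun := fun r => TrivSqZeroExt.inl (aug r) +
      TrivSqZeroExt.inr (lam ((maximalIdeal R).toCotangent (cotProj aug r)))
    map_one' := by
      have h1 : cotProj aug 1 = 0 := Subtype.ext (by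
        change (1 : R) - algebraMap k R (aug 1) = 0
        rw [map_one, map_one, sub_self])
      rw [map_one, h1, map_zero, map_zero, TrivSqZeroExt.inr_zero, add_zero, TrivSqZeroExt.inl_one]
    map_mul' := fun r s => by
      refine TrivSqZeroExt.ext ?_ ?_
      · simp only [TrivSqZeroExt.fst_add, TrivSqZeroExt.fst_inl, TrivSqZeroExt.fst_inr, add_zero, TrivSqZeroExt.fst_mul,
          map_mul]
      · simp only [TrivSqZeroExt.snd_add, TrivSqZeroExt.snd_inl, TrivSqZeroExt.snd_inr, zero_add, TrivSqZeroExt.snd_mul,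
          TrivSqZeroExt.fst_add, TrivSqZeroExt.fst_inl, TrivSqZeroExt.fst_inr, add_zero, op_smul_eq_smul]
        rw [toCotangent_cotProj_mul aug, map_add, map_smul, map_smul]
    map_zero' := by
      rw [map_zero, map_zero, map_zero, map_zero, TrivSqZeroExt.inl_zero, TrivSqZeroExt.inr_zero, add_zero]
    map_add' := fun r s => by
      rw [map_add, map_add, map_add, map_add, TrivSqZeroExt.inl_add, TrivSqZeroExt.inr_add]
      abel
    commutes' := fun c => by
      have hc : cotProj aug (algebraMap k R c) = 0 := Subtype.ext (by
        change algebraMap k R c - algebraMap k R (aug (algebraMap k R c)) = 0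
        rw [AlgHom.commutes, sub_eq_zero]; rfl)
      rw [hc, map_zero, map_zero, TrivSqZeroExt.inr_zero, add_zero, AlgHom.commutes, TrivSqZeroExt.algebraMap_eq_inl]
      rfl }

omit [IsNoetherianRing R] in
/-- On `x ∈ 𝔪` the `ε`-part of `φ_λ(x)` is `λ[x]`. [cite: Schlessinger1968, (2.6), p. 211] -/
theorem cotPoint_snd_coe (lam : (maximalIdeal R).Cotangent →ₗ[k] k) (x : ↥(maximalIdeal R)) :
    (show TrivSqZeroExt k k from cotPoint aug lam x).snd = lam ((maximalIdeal R).toCotangent x) := by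
  change (TrivSqZeroExt.inl (aug x) + TrivSqZeroExt.inr (lam ((maximalIdeal R).toCotangent (cotProj aug x))) :
    TrivSqZeroExt k k).snd = _
  rw [cotProj_coe, TrivSqZeroExt.snd_add, TrivSqZeroExt.snd_inl, TrivSqZeroExt.snd_inr, zero_add]

omit [IsNoetherianRing R] in
include aug in
/-- **The cotangent step of [Prop. 2.9]:** if every `φ : R → k[ε]` satisfies `φ ∘ w = φ`, then `w ≡ id (mod 𝔪_R²)` —
the points `r ↦ pt(r) + λ[r − pt(r)] ε` of `k[ε]` (`TangentSpaceOfPoints.lean`) detect the cotangent space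
`𝔪/𝔪²`, whose linear functionals separate points. [cite: Schlessinger1968, Prop. 2.9 (proof) with (2.6)
(`t_R = (𝔪/𝔪²)^*`), p. 211] -/
theorem sub_mem_sq_of_forall_comp_eq (w : R →ₐ[k] R)
    (hw : ∀ φ : R →ₐ[k] ↥(ArtAlg.sqZeroExt (k := k) k), φ.comp w = φ) (x : R) : w x - x ∈ maximalIdeal R ^ 2 := by
  -- reduce to `x ∈ 𝔪`: `w` fixes `algebraMap k R (aug x)`
  suffices key : ∀ m ∈ maximalIdeal R, w m - m ∈ maximalIdeal R ^ 2 by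
    have e : w x - x = w (x - algebraMap k R (aug x)) - (x - algebraMap k R (aug x)) := by
      rw [map_sub, AlgHom.commutes]; ring
    rw [e]; exact key _ (sub_algebraMap_aug_mem aug x)
  intro m hm
  have hwm : w m ∈ maximalIdeal R := map_maximalIdeal_le_of_endo aug w (Ideal.mem_map_of_mem _ hm)
  -- the class `[w m − m] ∈ 𝔪/𝔪²` is killed by every linear functional
  have hzero : (maximalIdeal R).toCotangent ⟨w m - m, sub_mem hwm hm⟩ = 0 := by
    rw [← Module.forall_dual_apply_eq_zero_iff k]
    intro lam
    have h1 := cotPoint_snd_coe aug lam ⟨w m, hwm⟩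
    have h2 := cotPoint_snd_coe aug lam ⟨m, hm⟩
    have h3 : cotPoint aug lam (w m) = cotPoint aug lam m := by
      change (cotPoint aug lam).comp w m = _
      congr 1
      exact hw _
    have h4 : (⟨w m - m, sub_mem hwm hm⟩ : ↥(maximalIdeal R)) = ⟨w m, hwm⟩ - ⟨m, hm⟩ := rfl
    rw [h4, map_sub, map_sub, ← h1, ← h2, h3, sub_self]
  exact (Ideal.toCotangent_eq_zero _ _).1 hzero

/-! ### From `w ≡ id (mod 𝔪²)` to `w` bijective (`R` complete): levelwise surjective (cotangent criterion), levelwise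
bijective (finite `k`-dimension), inverse by the universal property of the complete ring -/

omit [IsNoetherianRing R] in
include aug in
/-- An endomorphism maps `𝔪^j` into `𝔪^j`. [cite: Schlessinger1968, Prop. 2.9 (proof), p. 211–212] -/
theorem map_pow_le_of_endo (w : R →ₐ[k] R) (j : ℕ) : (maximalIdeal R ^ j).map w ≤ maximalIdeal R ^ j := by
  rw [Ideal.map_pow]; exact Ideal.pow_right_mono (map_maximalIdeal_le_of_endo aug w) j

/-- `𝔪^{j+1} ⊆ ker (R → R/𝔪^{j+1} ∘ w)`, so `w` descends to every level. [cite: Schlessinger1968, Prop. 2.9 (proof), p. 211–212] -/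
theorem pow_le_ker_mkQ_comp (w : R →ₐ[k] R) (j : ℕ) :
    maximalIdeal R ^ (j + 1) ≤ RingHom.ker ((mkQ R aug j).comp w) := fun x hx => by
  rw [RingHom.mem_ker]
  change mkQ R aug j (w x) = 0
  exact (mkQ_eq_zero_iff R aug j _).2 (map_pow_le_of_endo aug w (j + 1) (Ideal.mem_map_of_mem _ hx))

/-- The endomorphism `w̄_j` of `R/𝔪^{j+1}` induced by `w`. [cite: Schlessinger1968, Prop. 2.9 (proof), p. 211–212] -/
def endoQ (w : R →ₐ[k] R) (j : ℕ) : ↥(Q R aug j) →ₐ[k] ↥(Q R aug j) :=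
  bar R aug j ((mkQ R aug j).comp w) (pow_le_ker_mkQ_comp aug w j)

/-- `w̄_j ∘ (R → R/𝔪^{j+1}) = (R → R/𝔪^{j+1}) ∘ w`. [cite: Schlessinger1968, Prop. 2.9 (proof), p. 211–212] -/
theorem endoQ_comp_mkQ (w : R →ₐ[k] R) (j : ℕ) : (endoQ aug w j).comp (mkQ R aug j) = (mkQ R aug j).comp w :=
  bar_comp_mkQ R aug j _ _

/-- The induced endomorphisms `w̄_j` are compatible with the projections. [cite: Schlessinger1968, Prop. 2.9 (proof), p. 211–212] -/
theorem proj_comp_endoQ (w : R →ₐ[k] R) {m n : ℕ} (h : m ≤ n) :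
    (proj R aug h).comp (endoQ aug w n) = (endoQ aug w m).comp (proj R aug h) := by
  refine Ideal.Quotient.algHom_ext _ ?_
  change ((proj R aug h).comp (endoQ aug w n)).comp (mkQ R aug n) = ((endoQ aug w m).comp (proj R aug h)).comp (mkQ R aug n)
  rw [AlgHom.comp_assoc, endoQ_comp_mkQ, ← AlgHom.comp_assoc, proj_comp_mkQ, AlgHom.comp_assoc, proj_comp_mkQ,
    endoQ_comp_mkQ]

/-- **Levelwise surjectivity from `w ≡ id (mod 𝔪²)`** — the cotangent criterion
(`Literature.RingTheory.CompleteLocalRings.surjective_mk_pow_comp`: onto on the residue field and on `𝔪/𝔪²` ⇒ onto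
modulo every `𝔪^j`). [cite: Schlessinger1968, Prop. 2.9 (proof: «so that `u'u` is an isomorphism»), p. 211, with
Lemma 1.1 p. 209] -/
theorem endoQ_surjective (w : R →ₐ[k] R) (hw : ∀ x, w x - x ∈ maximalIdeal R ^ 2) (j : ℕ) :
    Function.Surjective (endoQ aug w j) := by
  have hφ : (maximalIdeal R).map (w : R →+* R) ≤ maximalIdeal R := map_maximalIdeal_le_of_endo aug w
  have hres : ∀ b : R, ∃ a : R, (w : R →+* R) a - b ∈ maximalIdeal R := fun b =>
    ⟨b, Ideal.pow_le_self two_ne_zero (hw b)⟩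
  have hcot : ∀ y ∈ maximalIdeal R, ∃ x ∈ maximalIdeal R, (w : R →+* R) x - y ∈ maximalIdeal R ^ 2 :=
    fun y hy => ⟨y, hy, hw y⟩
  have hs := Literature.RingTheory.CompleteLocalRings.surjective_mk_pow_comp (w : R →+* R) hφ hres hcot (j + 1)
  intro y
  obtain ⟨a, ha⟩ := hs y
  exact ⟨mkQ R aug j a, by rw [← AlgHom.comp_apply, endoQ_comp_mkQ]; exact ha⟩

/-- Levelwise bijectivity (`R/𝔪^{j+1}` is a finite-dimensional `k`-vector space). [cite: Schlessinger1968,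
Prop. 2.9 (proof), p. 211] -/
theorem endoQ_bijective (w : R →ₐ[k] R) (hw : ∀ x, w x - x ∈ maximalIdeal R ^ 2) (j : ℕ) :
    Function.Bijective (endoQ aug w j) := by
  haveI : Module.Finite k ↥(Q R aug j) := (Q R aug j).moduleFinite
  exact ⟨(LinearMap.injective_iff_surjective (f := (endoQ aug w j).toLinearMap)).2 (endoQ_surjective aug w hw j),
    endoQ_surjective aug w hw j⟩

/-- The levelwise automorphisms `w̄_j`. [cite: Schlessinger1968, Prop. 2.9 (proof), p. 211–212] -/
def endoQEquiv (w : R →ₐ[k] R) (hw : ∀ x, w x - x ∈ maximalIdeal R ^ 2) (j : ℕ) : ↥(Q R aug j) ≃ₐ[k] ↥(Q R aug j) :=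
  AlgEquiv.ofBijective (endoQ aug w j) (endoQ_bijective aug w hw j)

/-- The levelwise inverses `w̄_j⁻¹` are compatible with the projections. [cite: Schlessinger1968, Prop. 2.9 (proof), p. 211–212] -/
theorem proj_comp_endoQEquiv_symm (w : R →ₐ[k] R) (hw : ∀ x, w x - x ∈ maximalIdeal R ^ 2) {m n : ℕ} (h : m ≤ n) :
    (proj R aug h).comp ((endoQEquiv aug w hw n).symm : ↥(Q R aug n) →ₐ[k] ↥(Q R aug n)) =
      ((endoQEquiv aug w hw m).symm : ↥(Q R aug m) →ₐ[k] ↥(Q R aug m)).comp (proj R aug h) := by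
  refine AlgHom.ext fun y => ?_
  obtain ⟨z, rfl⟩ := (endoQEquiv aug w hw n).surjective y
  change proj R aug h ((endoQEquiv aug w hw n).symm (endoQEquiv aug w hw n z)) =
    (endoQEquiv aug w hw m).symm (proj R aug h (endoQ aug w n z))
  rw [AlgEquiv.symm_apply_apply, ← AlgHom.comp_apply, proj_comp_endoQ, AlgHom.comp_apply]
  exact ((endoQEquiv aug w hw m).symm_apply_apply _).symm

/-- The compatible family `R → R/𝔪^m` of the inverse. [cite: Schlessinger1968, Prop. 2.9 (proof), p. 211–212] -/
def invFamily (w : R →ₐ[k] R) (hw : ∀ x, w x - x ∈ maximalIdeal R ^ 2) (m : ℕ) : R →ₐ[k] R ⧸ maximalIdeal R ^ m :=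
  (Ideal.Quotient.factorₐ k (Ideal.pow_le_pow_right (Nat.le_succ m))).comp
    (((endoQEquiv aug w hw m).symm : ↥(Q R aug m) →ₐ[k] ↥(Q R aug m)).comp (mkQ R aug m))

/-- The family of levelwise inverses is compatible (hypothesis of the adic universal property). [cite: Schlessinger1968, Prop. 2.9 (proof), p. 211–212] -/
theorem invFamily_compat (w : R →ₐ[k] R) (hw : ∀ x, w x - x ∈ maximalIdeal R ^ 2) {m n : ℕ} (hle : m ≤ n) :
    (Ideal.Quotient.factorₐ k (Ideal.pow_le_pow_right hle)).comp (invFamily aug w hw n) = invFamily aug w hw m := by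
  have key : ((endoQEquiv aug w hw m).symm : ↥(Q R aug m) →ₐ[k] ↥(Q R aug m)).comp (mkQ R aug m) =
      (proj R aug hle).comp (((endoQEquiv aug w hw n).symm : ↥(Q R aug n) →ₐ[k] ↥(Q R aug n)).comp (mkQ R aug n)) := by
    rw [← AlgHom.comp_assoc, proj_comp_endoQEquiv_symm, AlgHom.comp_assoc, proj_comp_mkQ]
  unfold invFamily
  rw [key]
  refine AlgHom.ext fun x => ?_
  change (Ideal.Quotient.factorₐ k (Ideal.pow_le_pow_right hle))
      ((Ideal.Quotient.factorₐ k (Ideal.pow_le_pow_right (Nat.le_succ n)))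
        ((endoQEquiv aug w hw n).symm (mkQ R aug n x))) =
    (Ideal.Quotient.factorₐ k (Ideal.pow_le_pow_right (Nat.le_succ m)))
      (proj R aug hle ((endoQEquiv aug w hw n).symm (mkQ R aug n x)))
  generalize (endoQEquiv aug w hw n).symm (mkQ R aug n x) = y
  obtain ⟨z, rfl⟩ := Ideal.Quotient.mk_surjective y
  rfl

variable [IsAdicComplete (maximalIdeal R) R]

/-- The inverse of `w`, from the levelwise inverses by completeness. [cite: Schlessinger1968, §1 p. 209 (`Ĉ`)] -/
def inv (w : R →ₐ[k] R) (hw : ∀ x, w x - x ∈ maximalIdeal R ^ 2) : R →ₐ[k] R :=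
  IsAdicComplete.liftAlgHom (maximalIdeal R) (invFamily aug w hw) (invFamily_compat aug w hw)

/-- The inverse reduces to `w̄_j⁻¹` at every level. [cite: Schlessinger1968, Prop. 2.9 (proof), p. 211–212] -/
theorem mkQ_comp_inv (w : R →ₐ[k] R) (hw : ∀ x, w x - x ∈ maximalIdeal R ^ 2) (j : ℕ) :
    (mkQ R aug j).comp (inv aug w hw) =
      ((endoQEquiv aug w hw j).symm : ↥(Q R aug j) →ₐ[k] ↥(Q R aug j)).comp (mkQ R aug j) := by
  refine AlgHom.ext fun x => ?_
  have h := AlgHom.congr_fun (IsAdicComplete.mkₐ_comp_liftAlgHom (maximalIdeal R) (invFamily aug w hw)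
    (invFamily_compat aug w hw) (j + 1)) x
  refine h.trans ?_
  -- `invFamily (j+1) = proj ∘ e_{j+1}⁻¹ ∘ mkQ (j+1) = e_j⁻¹ ∘ mkQ j`
  have key := AlgHom.congr_fun (proj_comp_endoQEquiv_symm aug w hw (Nat.le_succ j)) (mkQ R aug (j + 1) x)
  exact key

include aug in
/-- **`w` is an automorphism** («so that `u'u` is an isomorphism»): an endomorphism of a complete local Noetherian
`k`-algebra with residue field `k` which is the identity modulo `𝔪²` is bijective. [cite: Schlessinger1968,
Prop. 2.9 (proof), p. 211] -/
theorem bijective_of_sub_mem_sq (w : R →ₐ[k] R) (hw : ∀ x, w x - x ∈ maximalIdeal R ^ 2) :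
    Function.Bijective w := by
  have h0 : Subsingleton (R ⧸ maximalIdeal R ^ 0) :=
    Ideal.Quotient.subsingleton_iff.2 (by rw [pow_zero, Ideal.one_eq_top])
  have h1 : w.comp (inv aug w hw) = AlgHom.id k R := by
    refine IsAdicComplete.algHom_ext (maximalIdeal R) fun n => ?_
    cases n with
    | zero => exact AlgHom.ext fun _ => Subsingleton.elim _ _
    | succ j =>
      change (mkQ R aug j).comp (w.comp (inv aug w hw)) = (mkQ R aug j).comp (AlgHom.id k R)
      rw [← AlgHom.comp_assoc, ← endoQ_comp_mkQ, AlgHom.comp_assoc, mkQ_comp_inv, ← AlgHom.comp_assoc,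
        AlgHom.comp_id]
      refine AlgHom.ext fun x => ?_
      exact (endoQEquiv aug w hw j).apply_symm_apply _
  have h2 : (inv aug w hw).comp w = AlgHom.id k R := by
    refine IsAdicComplete.algHom_ext (maximalIdeal R) fun n => ?_
    cases n with
    | zero => exact AlgHom.ext fun _ => Subsingleton.elim _ _
    | succ j =>
      change (mkQ R aug j).comp ((inv aug w hw).comp w) = (mkQ R aug j).comp (AlgHom.id k R)
      rw [← AlgHom.comp_assoc, mkQ_comp_inv, AlgHom.comp_assoc, ← endoQ_comp_mkQ, ← AlgHom.comp_assoc,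
        AlgHom.comp_id]
      refine AlgHom.ext fun x => ?_
      change (endoQEquiv aug w hw j).symm (endoQEquiv aug w hw j (mkQ R aug j x)) = mkQ R aug j x
      exact (endoQEquiv aug w hw j).symm_apply_apply _
  constructor
  · intro x y hxy
    have := congrArg (inv aug w hw) hxy
    rwa [← AlgHom.comp_apply, ← AlgHom.comp_apply, h2] at this
  · intro y
    exact ⟨inv aug w hw y, by rw [← AlgHom.comp_apply, h1]; rfl⟩

/-- An endomorphism of a HULL is bijective: it acts trivially on `t_R → t_F` (a bijection), hence is the identity on
the cotangent space, hence an automorphism. [cite: Schlessinger1968, Prop. 2.9 (proof), p. 211] -/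
theorem bijective_of_isHull_of_isMorphism {ξ : ∀ n, F.obj (Q R aug n)}
    (hR : IsHull F R aug ξ) {w : R →ₐ[k] R} (hw : IsMorphism F R aug R aug ξ ξ w) : Function.Bijective w := by
  refine bijective_of_sub_mem_sq aug w (sub_mem_sq_of_forall_comp_eq aug w (fun φ => ?_))
  exact hR.2.2.1 (eval_comp_endo hR.1 hw φ)

variable [IsAdicComplete (maximalIdeal R') R']

/-- **[Schlessinger1968, Prop. 2.9]: the hull is unique up to non-canonical isomorphism.** «Let `(R, ξ)` and
`(R', ξ')` be hulls of `F`. Then there exists an isomorphism `u : R → R'` (not unique!) such that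
`F̂(u)(ξ) = ξ'`.» Printed proof: by versality there are morphisms `u : (R, ξ) → (R', ξ')` and `u' : (R', ξ') → (R, ξ)`;
`u'u` (resp. `uu'`) induces the identity on `t_R` (resp. `t_{R'}`), «so that `u'u` is an isomorphism» (a local
endomorphism of a complete Noetherian local ring inducing an isomorphism on the cotangent space is an
automorphism), hence so is `u`. Here for `F(k) = {pt}` and hulls in the sense of `IsHull` ([Def. 2.7]: `ξ̂ ∈ F̂(R)`
compatible, `h_R → F` smooth along the surjections of `Art_k`, `t_R → t_F` bijective), `R, R'` complete local
Noetherian `k`-algebras with residue field `k`. [cite: Schlessinger1968, Prop. 2.9 and (2.8), p. 211] -/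
theorem exists_algEquiv_of_isHull (pt : F.obj (ArtAlg.base k)) (hpt : ∀ a, a = pt)
    {ξ : ∀ n, F.obj (Q R aug n)} {ξ' : ∀ n, F.obj (Q R' aug' n)} (hR : IsHull F R aug ξ) (hR' : IsHull F R' aug' ξ') :
    ∃ e : R ≃ₐ[k] R', IsMorphism F R aug R' aug' ξ ξ' (e : R →ₐ[k] R') := by
  -- by versality, morphisms both ways
  obtain ⟨u, hu⟩ := exists_morphism_of_isFormallySmooth (R' := R') (aug' := aug') pt hpt hR.2.1 hR'.1
  obtain ⟨u', hu'⟩ := exists_morphism_of_isFormallySmooth (R' := R) (aug' := aug) pt hpt hR'.2.1 hR.1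
  -- `u'u` and `uu'` are automorphisms
  have h1 : Function.Bijective (u'.comp u) :=
    bijective_of_isHull_of_isMorphism aug hR (IsMorphism.comp hR.1 hR'.1 hu hu')
  have h2 : Function.Bijective (u.comp u') :=
    bijective_of_isHull_of_isMorphism aug' hR' (IsMorphism.comp hR'.1 hR.1 hu' hu)
  have hbij : Function.Bijective u :=
    ⟨Function.Injective.of_comp (f := u') h1.1, Function.Surjective.of_comp (g := u') h2.2⟩
  exact ⟨AlgEquiv.ofBijective u hbij, hu⟩

omit [IsAdicComplete (maximalIdeal R) R] in
/-- **Uniqueness of morphisms out of a pro-representing couple** ([Thm. 2.11 (2)]: when `h_R(A) → F(A)` is injective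
for every `A`, the isomorphism of [Prop. 2.9] is UNIQUE; cf. (2.18): without (H₄) the hull may have automorphisms):
two morphisms of couples `(R, ξ̂) → (R', ξ̂')` agree modulo every `𝔪'^{n+1}` (both push `ξ̂` to `ξ̂'_n`), hence are
equal (`R'` complete). [cite: Schlessinger1968, Thm. 2.11 (2) p. 212 and (2.18) p. 215, with Def. 2.7 p. 211] -/
theorem morphism_unique_of_eval_injective {ξ : ∀ n, F.obj (Q R aug n)} {ξ' : ∀ n, F.obj (Q R' aug' n)}
    (hinj : ∀ (A : ArtAlg.{u} k), Function.Injective fun u : R →ₐ[k] ↥A => eval F R aug ξ u)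
    {u₁ u₂ : R →ₐ[k] R'} (h₁ : IsMorphism F R aug R' aug' ξ ξ' u₁) (h₂ : IsMorphism F R aug R' aug' ξ ξ' u₂) :
    u₁ = u₂ := by
  have h0 : Subsingleton (R' ⧸ maximalIdeal R' ^ 0) :=
    Ideal.Quotient.subsingleton_iff.2 (by rw [pow_zero, Ideal.one_eq_top])
  refine IsAdicComplete.algHom_ext (maximalIdeal R') fun n => ?_
  cases n with
  | zero => exact AlgHom.ext fun _ => Subsingleton.elim _ _
  | succ j =>
    change (mkQ R' aug' j).comp u₁ = (mkQ R' aug' j).comp u₂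
    exact hinj (Q R' aug' j) ((h₁ j).trans (h₂ j).symm)

end Uniqueness

/-! ## §5 [§2 p. 210, (2.8)]: a pro-representing couple is a hull, and it is unique up to CANONICAL isomorphism -/

section ProRepresents

/-- **«We therefore say that a pro-couple `(R, ξ)` for `F` pro-represents `F` if the morphism `h_R → F` induced by
`ξ` is an isomorphism»** ([Schlessinger1968, §2 p. 210], the morphism being `u ↦ F(u_n)(ξ_n)` for `u : R → A`
factoring through `u_n : R/𝔪ⁿ → A`): `ξ̂ ∈ F̂(R)` is a compatible family and `u ↦ u_* ξ̂ : Hom_k(R, A) → F(A)`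
(`Formal.eval`) is bijective for every `A` in `Art_k`. [cite: Schlessinger1968, §2 p. 210 («pro-represents»)] -/
def ProRepresents (ξ : ∀ n, F.obj (Q R aug n)) : Prop :=
  IsFormalElt F ξ ∧ ∀ A : ArtAlg.{u} k, Function.Bijective fun u : R →ₐ[k] ↥A => eval F R aug ξ u

variable {F R aug R' aug'}

/-- **[Schlessinger1968, (2.8)], first sentence: «Notice that if `(R, ξ)` pro-represents `F` then `(R, ξ)` is a hull
of `F`.»** Smoothness of `h_R → F` ([Def. 2.2]) along a surjection `p : A' → A`: for `u : R → A` and `η' ∈ F(A')`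
over `u_* ξ̂`, surjectivity of `h_R(A') → F(A')` gives `u'` with `u'_* ξ̂ = η'`, and `(p ∘ u')_* ξ̂ = F(p)(η') = u_* ξ̂`
forces `p ∘ u' = u` by injectivity of `h_R(A) → F(A)`; bijectivity of `t_R → t_F` ([Def. 2.7]) is the case
`A = k[ε]`. [cite: Schlessinger1968, (2.8) p. 211, with §2 p. 210, Def. 2.2 p. 210 and Def. 2.7 p. 211] -/
theorem ProRepresents.isHull {ξ : ∀ n, F.obj (Q R aug n)} (h : ProRepresents F R aug ξ) : IsHull F R aug ξ := by
  refine ⟨h.1, ?_, h.2 _⟩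
  intro A' A p _ u η' hη'
  obtain ⟨u', hu'⟩ := (h.2 A').2 η'
  have hu'' : eval F R aug ξ u' = η' := hu'
  have key : eval F R aug ξ (p.comp u') = eval F R aug ξ u := by
    rw [eval_comp R aug h.1, hu'', hη']
  exact ⟨u', (h.2 A).1 key, hu''⟩

/-- Out of a pro-representing couple, morphisms of couples are unique (the hypothesis of
`morphism_unique_of_eval_injective` holds). [cite: Schlessinger1968, (2.8) p. 211 and Thm. 2.11 (2) p. 212] -/
theorem ProRepresents.eval_injective {ξ : ∀ n, F.obj (Q R aug n)} (h : ProRepresents F R aug ξ) (A : ArtAlg.{u} k) :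
    Function.Injective fun u : R →ₐ[k] ↥A => eval F R aug ξ u :=
  (h.2 A).1

variable (aug aug')
variable [IsAdicComplete (maximalIdeal R) R] [IsAdicComplete (maximalIdeal R') R']

/-- **[Schlessinger1968, (2.8)], second sentence: «In this case `(R, ξ)` is unique up to canonical isomorphism.»**
If `(R, ξ̂)` and `(R', ξ̂')` both pro-represent `F` (`F(k)` one point; `R`, `R'` complete local Noetherian
`k`-algebras with residue field `k`), there is EXACTLY ONE isomorphism of couples `e : R ≅ R'` with `F̂(e)(ξ̂) = ξ̂'`:
existence by [Prop. 2.9] (both couples are hulls by the first sentence of (2.8)), uniqueness because morphisms of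
couples out of a pro-representing couple are unique (`morphism_unique_of_eval_injective`) — «In general we have only
noncanonical isomorphism» (Prop. 2.9, `exists_algEquiv_of_isHull`).
[cite: Schlessinger1968, (2.8) p. 211, with Prop. 2.9 pp. 211–212] -/
theorem ProRepresents.existsUnique_algEquiv (pt : F.obj (ArtAlg.base k)) (hpt : ∀ a, a = pt)
    {ξ : ∀ n, F.obj (Q R aug n)} {ξ' : ∀ n, F.obj (Q R' aug' n)}
    (hR : ProRepresents F R aug ξ) (hR' : ProRepresents F R' aug' ξ') :
    ∃! e : R ≃ₐ[k] R', IsMorphism F R aug R' aug' ξ ξ' (e : R →ₐ[k] R') := by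
  obtain ⟨e, he⟩ := exists_algEquiv_of_isHull aug pt hpt hR.isHull hR'.isHull
  refine ⟨e, he, fun e' he' => AlgEquiv.coe_toAlgHom_injective ?_⟩
  exact morphism_unique_of_eval_injective aug hR.eval_injective he' he

omit [IsAdicComplete (maximalIdeal R) R] [IsAdicComplete (maximalIdeal R') R'] in
/-- The canonical isomorphism of (2.8) is compatible with composition: for pro-representing couples `(R, ξ̂)`,
`(R', ξ̂')` and any formal couple `(R'', ξ̂'')` over a complete `R''`, isomorphisms of couples `e₁ : R ≅ R'`,
`e₂ : R' ≅ R''`, `e₃ : R ≅ R''` satisfy `e₃ = e₂ ∘ e₁` («canonical»). [cite: Schlessinger1968, (2.8) p. 211] -/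
theorem ProRepresents.algEquiv_trans {R'' : Type u} [CommRing R''] [Algebra k R''] [IsLocalRing R'']
    [IsNoetherianRing R''] (aug'' : R'' →ₐ[k] k) [IsAdicComplete (maximalIdeal R'') R'']
    {ξ : ∀ n, F.obj (Q R aug n)} {ξ' : ∀ n, F.obj (Q R' aug' n)} {ξ'' : ∀ n, F.obj (Q R'' aug'' n)}
    (hR : ProRepresents F R aug ξ) (hR' : ProRepresents F R' aug' ξ')
    {e₁ : R ≃ₐ[k] R'} {e₂ : R' ≃ₐ[k] R''} {e₃ : R ≃ₐ[k] R''}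
    (h₁ : IsMorphism F R aug R' aug' ξ ξ' (e₁ : R →ₐ[k] R'))
    (h₂ : IsMorphism F R' aug' R'' aug'' ξ' ξ'' (e₂ : R' →ₐ[k] R''))
    (h₃ : IsMorphism F R aug R'' aug'' ξ ξ'' (e₃ : R →ₐ[k] R'')) : e₃ = e₁.trans e₂ := by
  refine AlgEquiv.coe_toAlgHom_injective ?_
  have h12 : IsMorphism F R aug R'' aug'' ξ ξ'' ((e₂ : R' →ₐ[k] R'').comp (e₁ : R →ₐ[k] R')) :=
    IsMorphism.comp hR.1 hR'.1 h₁ h₂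
  have : ((e₁.trans e₂ : R ≃ₐ[k] R'') : R →ₐ[k] R'') = (e₂ : R' →ₐ[k] R'').comp (e₁ : R →ₐ[k] R') := rfl
  rw [this]
  exact morphism_unique_of_eval_injective aug hR.eval_injective h₃ h12

end ProRepresents

end Formal

end

end Literature.AlgebraicGeometry.Deformation
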